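import Literature.AlgebraicGeometry.Surfaces.HirzebruchTwoChartCalculus
import HarnessLib

/-!
# Support bounds for the chart transforms of `𝔽₂`: calculus of `deg_y ≤ α` and `i ≤ N + 2j`, powers, monomial values

Topic `Literature/AlgebraicGeometry/Surfaces`, namespace `Literature.AlgebraicGeometry.Surfaces.HirzebruchTwoDoublePlane` (sequel of
`HirzebruchTwoChartCalculus`). Theorems only; no definition, no named fact. Written by the prover seat
`leafhand-hodge-q8symplecticpowers-4` (g5, cell `pub-hsemireg`) for target (T2) of memo NINTH-HAND-S1-DESIGN-leafhand4-g5 (route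
`HodgeConjecture/Q8SymplecticPowers`, crux K1Q, stmt-HodgeConjecture-24190, stub S1): the multiplicativity lemmas `chartTwo_mul`,
`chartThree_mul`, `chartFour_mul` and the exactness predicate `IsChartExact` are stated under the support bounds
`∀ m ∈ supp F, m 1 ≤ α` («`deg_y F ≤ α`») and `∀ m ∈ supp F, m 0 ≤ N + 2·(m 1)` («pole order along `f_∞` at most `N`»); here is
the calculus that propagates them through sums, products and powers and evaluates them (and the transforms) on `C c`, `X 0`, `X 1`.
[Hartshorne1977, V.2: on `𝔽₂ = ℙ(𝒪 ⊕ 𝒪(−2))`, `div(y) = E + 2f_∞ − σ_∞`, `div(s) = f₀ − f_∞`, so a monomial `sⁱyʲ` has pole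
order `i − 2j` along `f_∞` and `j` along `σ_∞`.]

## What is here

* `yBound_*` : the bound `m 1 ≤ α` for `C`, `X 0`, `X 1`, `monomial`, under `+`, `*` (`α₁ + α₂`), `^ n` (`n * α`), and monotone in `α`;
* `poleBound_*` : the bound `m 0 ≤ N + 2·m 1` likewise (`N = 0` for `C`, `X 1`; `N = 1` for `X 0`);
* `chartTwo_pow`, `chartThree_pow`, `chartFour_pow`; `chartThree_C`, `chartThree_X_zero`, `chartThree_X_one`, `chartTwo_C`,
  `chartTwo_X_one`, `chartTwo_X_zero_mul_X_one`-type values via `chart*_monomial`.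

Honest scope: bookkeeping; nothing here bears on HC; S1 ∕ K1Q NOT proved here.
-/

set_option autoImplicit false

open MvPolynomial
open scoped Pointwise

namespace Literature.AlgebraicGeometry.Surfaces.HirzebruchTwoDoublePlane

variable {F G : MvPolynomial (Fin 2) ℂ}

/-! ### The bound `deg_y ≤ α` -/

/-- `deg_y` bound of a sum. [cite: Hartshorne1977, V.2 (ruled surfaces)] -/
theorem yBound_add {α : ℕ} (hF : ∀ m ∈ F.support, m 1 ≤ α) (hG : ∀ m ∈ G.support, m 1 ≤ α) :
    ∀ m ∈ (F + G).support, m 1 ≤ α := by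
  classical
  intro m hm
  rcases Finset.mem_union.1 (support_add hm) with h | h
  · exact hF m h
  · exact hG m h

/-- `deg_y` bound of a product. [cite: Hartshorne1977, V.2 (ruled surfaces)] -/
theorem yBound_mul {α₁ α₂ : ℕ} (hF : ∀ m ∈ F.support, m 1 ≤ α₁) (hG : ∀ m ∈ G.support, m 1 ≤ α₂) :
    ∀ m ∈ (F * G).support, m 1 ≤ α₁ + α₂ := by
  classical
  intro m hm
  obtain ⟨x, hx, y, hy, rfl⟩ := Finset.mem_add.1 (support_mul F G hm)
  rw [Finsupp.add_apply]
  exact Nat.add_le_add (hF x hx) (hG y hy)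

/-- `deg_y` bound is monotone. [cite: Hartshorne1977, V.2 (ruled surfaces)] -/
theorem yBound_mono {α β : ℕ} (h : α ≤ β) (hF : ∀ m ∈ F.support, m 1 ≤ α) : ∀ m ∈ F.support, m 1 ≤ β :=
  fun m hm => (hF m hm).trans h

/-- `deg_y` bound of a power. [cite: Hartshorne1977, V.2 (ruled surfaces)] -/
theorem yBound_pow {α : ℕ} (hF : ∀ m ∈ F.support, m 1 ≤ α) (n : ℕ) : ∀ m ∈ (F ^ n).support, m 1 ≤ n * α := by
  classical
  induction n with
  | zero =>
    intro m hm
    rw [pow_zero, ← C_1, C_apply] at hm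
    have h1 : m ∈ ({0} : Finset (Fin 2 →₀ ℕ)) := support_monomial_subset hm
    rw [Finset.mem_singleton] at h1
    simp [h1]
  | succ n ih =>
    intro m hm
    rw [pow_succ] at hm
    have := yBound_mul ih hF m hm
    simpa [Nat.succ_mul] using this

/-- `deg_y` bound of a monomial. [cite: Hartshorne1977, V.2 (ruled surfaces)] -/
theorem yBound_monomial (m₀ : Fin 2 →₀ ℕ) (c : ℂ) : ∀ m ∈ (monomial m₀ c).support, m 1 ≤ m₀ 1 := by
  classical
  intro m hm
  have h1 : m ∈ ({m₀} : Finset (Fin 2 →₀ ℕ)) := support_monomial_subset hm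
  rw [Finset.mem_singleton] at h1
  rw [h1]

/-- `deg_y (C c) ≤ 0`. [cite: Hartshorne1977, V.2 (ruled surfaces)] -/
theorem yBound_C (c : ℂ) : ∀ m ∈ (C c : MvPolynomial (Fin 2) ℂ).support, m 1 ≤ 0 := by
  intro m hm
  rw [C_apply] at hm
  simpa using yBound_monomial 0 c m hm

/-- `deg_y (X 0) ≤ 0`. [cite: Hartshorne1977, V.2 (ruled surfaces)] -/
theorem yBound_X_zero : ∀ m ∈ (X 0 : MvPolynomial (Fin 2) ℂ).support, m 1 ≤ 0 := by
  intro m hm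
  rw [X, ] at hm
  simpa using yBound_monomial (Finsupp.single 0 1) 1 m hm

/-- `deg_y (X 1) ≤ 1`. [cite: Hartshorne1977, V.2 (ruled surfaces)] -/
theorem yBound_X_one : ∀ m ∈ (X 1 : MvPolynomial (Fin 2) ℂ).support, m 1 ≤ 1 := by
  intro m hm
  rw [X] at hm
  simpa using yBound_monomial (Finsupp.single 1 1) 1 m hm

/-- `deg_y` bound of a difference. [cite: Hartshorne1977, V.2 (ruled surfaces)] -/
theorem yBound_sub {α : ℕ} (hF : ∀ m ∈ F.support, m 1 ≤ α) (hG : ∀ m ∈ G.support, m 1 ≤ α) :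
    ∀ m ∈ (F - G).support, m 1 ≤ α := by
  rw [sub_eq_add_neg]
  refine yBound_add hF fun m hm => hG m ?_
  rwa [support_neg] at hm

/-! ### The bound `i ≤ N + 2j` (pole order along `f_∞`) -/

/-- Pole bound of a sum. [cite: Hartshorne1977, V.2 (ruled surfaces)] -/
theorem poleBound_add {N : ℕ} (hF : ∀ m ∈ F.support, m 0 ≤ N + 2 * m 1) (hG : ∀ m ∈ G.support, m 0 ≤ N + 2 * m 1) :
    ∀ m ∈ (F + G).support, m 0 ≤ N + 2 * m 1 := by
  classical
  intro m hm
  rcases Finset.mem_union.1 (support_add hm) with h | h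
  · exact hF m h
  · exact hG m h

/-- Pole bound of a product. [cite: Hartshorne1977, V.2 (ruled surfaces)] -/
theorem poleBound_mul {N₁ N₂ : ℕ} (hF : ∀ m ∈ F.support, m 0 ≤ N₁ + 2 * m 1) (hG : ∀ m ∈ G.support, m 0 ≤ N₂ + 2 * m 1) :
    ∀ m ∈ (F * G).support, m 0 ≤ (N₁ + N₂) + 2 * m 1 := by
  classical
  intro m hm
  obtain ⟨x, hx, y, hy, rfl⟩ := Finset.mem_add.1 (support_mul F G hm)
  have h1 := hF x hx
  have h2 := hG y hy
  simp only [Finsupp.add_apply]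
  omega

/-- Pole bound is monotone. [cite: Hartshorne1977, V.2 (ruled surfaces)] -/
theorem poleBound_mono {N M : ℕ} (h : N ≤ M) (hF : ∀ m ∈ F.support, m 0 ≤ N + 2 * m 1) :
    ∀ m ∈ F.support, m 0 ≤ M + 2 * m 1 :=
  fun m hm => (hF m hm).trans (by omega)

/-- Pole bound of a power. [cite: Hartshorne1977, V.2 (ruled surfaces)] -/
theorem poleBound_pow {N : ℕ} (hF : ∀ m ∈ F.support, m 0 ≤ N + 2 * m 1) (n : ℕ) :
    ∀ m ∈ (F ^ n).support, m 0 ≤ n * N + 2 * m 1 := by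
  classical
  induction n with
  | zero =>
    intro m hm
    rw [pow_zero, ← C_1, C_apply] at hm
    have h1 : m ∈ ({0} : Finset (Fin 2 →₀ ℕ)) := support_monomial_subset hm
    rw [Finset.mem_singleton] at h1
    simp [h1]
  | succ n ih =>
    intro m hm
    rw [pow_succ] at hm
    have := poleBound_mul ih hF m hm
    simpa [Nat.succ_mul] using this

/-- Pole bound of a monomial. [cite: Hartshorne1977, V.2 (ruled surfaces)] -/
theorem poleBound_monomial (m₀ : Fin 2 →₀ ℕ) (c : ℂ) {N : ℕ} (h : m₀ 0 ≤ N + 2 * m₀ 1) :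
    ∀ m ∈ (monomial m₀ c).support, m 0 ≤ N + 2 * m 1 := by
  classical
  intro m hm
  have h1 : m ∈ ({m₀} : Finset (Fin 2 →₀ ℕ)) := support_monomial_subset hm
  rw [Finset.mem_singleton] at h1
  rw [h1]
  exact h

/-- Pole bound `0` for `C c`. [cite: Hartshorne1977, V.2 (ruled surfaces)] -/
theorem poleBound_C (c : ℂ) : ∀ m ∈ (C c : MvPolynomial (Fin 2) ℂ).support, m 0 ≤ 0 + 2 * m 1 := by
  intro m hm
  rw [C_apply] at hm
  exact poleBound_monomial 0 c (by simp) m hm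

/-- Pole bound `1` for `X 0` (`div s = f₀ − f_∞`). [cite: Hartshorne1977, V.2 (ruled surfaces)] -/
theorem poleBound_X_zero : ∀ m ∈ (X 0 : MvPolynomial (Fin 2) ℂ).support, m 0 ≤ 1 + 2 * m 1 := by
  intro m hm
  rw [X] at hm
  exact poleBound_monomial (Finsupp.single 0 1) 1 (by simp) m hm

/-- Pole bound `0` for `X 1` (`y` has a double ZERO along `f_∞`). [cite: Hartshorne1977, V.2 (ruled surfaces)] -/
theorem poleBound_X_one : ∀ m ∈ (X 1 : MvPolynomial (Fin 2) ℂ).support, m 0 ≤ 0 + 2 * m 1 := by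
  intro m hm
  rw [X] at hm
  exact poleBound_monomial (Finsupp.single 1 1) 1 (by simp) m hm

/-- Pole bound of a difference. [cite: Hartshorne1977, V.2 (ruled surfaces)] -/
theorem poleBound_sub {N : ℕ} (hF : ∀ m ∈ F.support, m 0 ≤ N + 2 * m 1) (hG : ∀ m ∈ G.support, m 0 ≤ N + 2 * m 1) :
    ∀ m ∈ (F - G).support, m 0 ≤ N + 2 * m 1 := by
  rw [sub_eq_add_neg]
  refine poleBound_add hF fun m hm => hG m ?_
  rwa [support_neg] at hm

/-! ### Powers and values of the chart transforms -/

/-- `chartThree` of a power. [cite: Hartshorne1977, V.2 (ruled surfaces)] -/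
theorem chartThree_pow {α : ℕ} (hF : ∀ m ∈ F.support, m 1 ≤ α) (n : ℕ) :
    chartThree (n * α) (F ^ n) = chartThree α F ^ n := by
  induction n with
  | zero =>
    rw [zero_mul, pow_zero, pow_zero, ← C_1, C_apply, chartThree_monomial]
    simp
  | succ n ih =>
    rw [pow_succ, pow_succ, Nat.succ_mul, chartThree_mul (yBound_pow hF n) hF, ih]

/-- `chartTwo` of a power. [cite: Hartshorne1977, V.2 (ruled surfaces)] -/
theorem chartTwo_pow {N : ℕ} (hF : ∀ m ∈ F.support, m 0 ≤ N + 2 * m 1) (n : ℕ) :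
    chartTwo (n * N) (F ^ n) = chartTwo N F ^ n := by
  induction n with
  | zero =>
    rw [zero_mul, pow_zero, pow_zero, ← C_1, C_apply, chartTwo_monomial]
    simp
  | succ n ih =>
    rw [pow_succ, pow_succ, Nat.succ_mul, chartTwo_mul (poleBound_pow hF n) hF, ih]

/-- `chartFour` of a power. [cite: Hartshorne1977, V.2 (ruled surfaces)] -/
theorem chartFour_pow {α N : ℕ} (hF : ∀ m ∈ F.support, m 1 ≤ α ∧ m 0 ≤ N + 2 * m 1) (n : ℕ) :
    chartFour (n * α) (n * N) (F ^ n) = chartFour α N F ^ n := by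
  induction n with
  | zero =>
    rw [zero_mul, zero_mul, pow_zero, pow_zero, ← C_1, C_apply, chartFour_monomial]
    simp
  | succ n ih =>
    have hb : ∀ m ∈ (F ^ n).support, m 1 ≤ n * α ∧ m 0 ≤ n * N + 2 * m 1 := fun m hm =>
      ⟨yBound_pow (fun m hm => (hF m hm).1) n m hm, poleBound_pow (fun m hm => (hF m hm).2) n m hm⟩
    rw [pow_succ, pow_succ, Nat.succ_mul, Nat.succ_mul, chartFour_mul hb hF, ih]

/-- Congruence of `monomial` in the exponent (plumbing). [folklore] -/
private theorem monomial_congr_exp {m m' : Fin 2 →₀ ℕ} (c : ℂ) (h : m = m') :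
    (monomial m c : MvPolynomial (Fin 2) ℂ) = monomial m' c := by rw [h]

/-- `chartThree α (C c) = c · v^α`. [cite: Hartshorne1977, V.2 (ruled surfaces)] -/
theorem chartThree_C (α : ℕ) (c : ℂ) : chartThree α (C c) = C c * X 1 ^ α := by
  rw [C_mul_X_pow_eq_monomial, C_apply, chartThree_monomial]
  apply monomial_congr_exp
  ext i
  fin_cases i <;> simp

/-- `chartThree α (X 0) = s · v^α`. [cite: Hartshorne1977, V.2 (ruled surfaces)] -/
theorem chartThree_X_zero (α : ℕ) : chartThree α (X 0 : MvPolynomial (Fin 2) ℂ) = X 0 * X 1 ^ α := by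
  rw [X_pow_eq_monomial, X, chartThree_monomial, monomial_mul, mul_one]
  apply monomial_congr_exp
  ext i
  fin_cases i <;> simp

/-- `chartThree α (X 1) = v^{α−1}` (`y = 1/v`). [cite: Hartshorne1977, V.2 (ruled surfaces)] -/
theorem chartThree_X_one (α : ℕ) : chartThree α (X 1 : MvPolynomial (Fin 2) ℂ) = X 1 ^ (α - 1) := by
  rw [X_pow_eq_monomial, X, chartThree_monomial]
  apply monomial_congr_exp
  ext i
  fin_cases i <;> simp

/-- `chartTwo N (C c) = c · s′^N`. [cite: Hartshorne1977, V.2 (ruled surfaces)] -/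
theorem chartTwo_C (N : ℕ) (c : ℂ) : chartTwo N (C c) = C c * X 0 ^ N := by
  rw [C_mul_X_pow_eq_monomial, C_apply, chartTwo_monomial]
  apply monomial_congr_exp
  ext i
  fin_cases i <;> simp

/-- `chartTwo N (X 0) = s′^{N−1}` (`s = 1/s′`). [cite: Hartshorne1977, V.2 (ruled surfaces)] -/
theorem chartTwo_X_zero (N : ℕ) : chartTwo N (X 0 : MvPolynomial (Fin 2) ℂ) = X 0 ^ (N - 1) := by
  rw [X_pow_eq_monomial, X, chartTwo_monomial]
  apply monomial_congr_exp
  ext i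
  fin_cases i <;> simp

/-- `chartTwo N (X 1) = s′^{N+2} · y′` (`y = s′² y′`). [cite: Hartshorne1977, V.2 (ruled surfaces)] -/
theorem chartTwo_X_one (N : ℕ) : chartTwo N (X 1 : MvPolynomial (Fin 2) ℂ) = X 0 ^ (N + 2) * X 1 := by
  rw [X_pow_eq_monomial, X, chartTwo_monomial, monomial_mul, mul_one]
  apply monomial_congr_exp
  ext i
  fin_cases i <;> simp

/-- `chartFour α N (C c) = c · s′^N · v′^α`. [cite: Hartshorne1977, V.2 (ruled surfaces)] -/
theorem chartFour_C (α N : ℕ) (c : ℂ) : chartFour α N (C c) = C c * (X 0 ^ N * X 1 ^ α) := by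
  rw [X_pow_eq_monomial, X_pow_eq_monomial, monomial_mul, mul_one, C_mul_monomial, mul_one, C_apply, chartFour_monomial]
  apply monomial_congr_exp
  ext i
  fin_cases i <;> simp

/-- `chartFour α N (X 0) = s′^{N−1} · v′^α`. [cite: Hartshorne1977, V.2 (ruled surfaces)] -/
theorem chartFour_X_zero (α N : ℕ) : chartFour α N (X 0 : MvPolynomial (Fin 2) ℂ) = X 0 ^ (N - 1) * X 1 ^ α := by
  rw [X_pow_eq_monomial, X_pow_eq_monomial, monomial_mul, mul_one, X, chartFour_monomial]
  apply monomial_congr_exp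
  ext i
  fin_cases i <;> simp

/-- `chartFour α N (X 1) = s′^{N+2} · v′^{α−1}`. [cite: Hartshorne1977, V.2 (ruled surfaces)] -/
theorem chartFour_X_one (α N : ℕ) : chartFour α N (X 1 : MvPolynomial (Fin 2) ℂ) = X 0 ^ (N + 2) * X 1 ^ (α - 1) := by
  rw [X_pow_eq_monomial, X_pow_eq_monomial, monomial_mul, mul_one, X, chartFour_monomial]
  apply monomial_congr_exp
  ext i
  fin_cases i <;> simp

/-! ### Negation and differences -/

/-- `monoTrans` commutes with negation. [cite: Hartshorne1977, V.2 (ruled surfaces)] -/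
theorem monoTrans_neg {k : Type*} [CommRing k] (φ : (Fin 2 →₀ ℕ) → (Fin 2 →₀ ℕ)) (G : MvPolynomial (Fin 2) k) :
    monoTrans φ (-G) = -monoTrans φ G := by
  have h := monoTrans_add φ G (-G)
  rw [add_neg_cancel, monoTrans_zero] at h
  exact (neg_eq_of_add_eq_zero_right h.symm).symm

/-- `chartThree` of a difference. [cite: Hartshorne1977, V.2 (ruled surfaces)] -/
theorem chartThree_sub (α : ℕ) (F G : MvPolynomial (Fin 2) ℂ) : chartThree α (F - G) = chartThree α F - chartThree α G := by
  rw [sub_eq_add_neg, chartThree_add, chartThree_eq_monoTrans α (-G), monoTrans_neg, ← chartThree_eq_monoTrans, sub_eq_add_neg]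

/-- `chartTwo` of a difference. [cite: Hartshorne1977, V.2 (ruled surfaces)] -/
theorem chartTwo_sub (N : ℕ) (F G : MvPolynomial (Fin 2) ℂ) : chartTwo N (F - G) = chartTwo N F - chartTwo N G := by
  rw [sub_eq_add_neg, chartTwo_add, chartTwo_eq_monoTrans N (-G), monoTrans_neg, ← chartTwo_eq_monoTrans, sub_eq_add_neg]

/-- `chartFour` of a difference. [cite: Hartshorne1977, V.2 (ruled surfaces)] -/
theorem chartFour_sub (α N : ℕ) (F G : MvPolynomial (Fin 2) ℂ) :
    chartFour α N (F - G) = chartFour α N F - chartFour α N G := by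
  rw [sub_eq_add_neg, chartFour_add, chartFour_eq_monoTrans α N (-G), monoTrans_neg, ← chartFour_eq_monoTrans, sub_eq_add_neg]

end Literature.AlgebraicGeometry.Surfaces.HirzebruchTwoDoublePlane
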